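import Mathlib
import Summits.NavierStokesRegularity.NavierStokesRegularity.Theorems.TaoLadderRungTwoFlatHopTubeWith
import Summits.NavierStokesRegularity.NavierStokesRegularity.Theorems.TaoLadderRungTwoFlatHopRuleGlue
import Summits.NavierStokesRegularity.NavierStokesRegularity.Theorems.TaoLadderRungTwoFlatBehindAprioriSharp
import HarnessLib

/-!
# HOP TUBE WITH a parametric behind clause (part 2 of 2) — theory-1 g45's re-typed frame for referee W-26 / A-102: the choice-rule adapters and the R54 instance ((B1) schedule ∧ (B2) existential)
  (helper for the K_A♭ parent item stmt-NavierStokesRegularity-22987 `FlatGapCertificatesV2`, child 2A `GradedAdiabaticWakeA`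
  of route TaoLadderRungTwoFlat; cell harvest/h2-tao-ladder, theory-1 g45, memo numT57/NEAR-BEHIND-57 §5 / LADDER §57.8)

PROVENANCE (p1 g23): theory-1 g45's image of record numT57/TubeFrameWith57.lean sha16 3eac36db9e3dc44f (386 l., farm `lean check`
rc 0 · 0 sorry · 0 warnings · std axioms), landed with declarations BYTE-IDENTICAL in TWO modules (400-line lint): part 1
`…HopTubeWith` (frame + composition: `InTubeWith`, `tubeSetWith`, `HopPremiseWith`, `TubeStep…With`, `TubeStaticsWith`,
`TubeExistWith`, `stepToWith_of_obligations`, `gapData₂On_of_tubeWith`, `gradedWake_clause_of_tubeWith`), part 2 `…HopTubeWithGlue`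
(choice-rule adapters `tubeStep…With_of_good` + the R54 instance `behindR54`, `behindCapR54_of_good`, `tubeStepBehindR54_of_good`,
`behindR54_of_hopPremiseWith`). The image's module docstring follows verbatim.

# Cell Lean (theory-1 g45, numT57): the `H(n)` tube frame PARAMETRIC in the behind clause, and its R54 instance
  (referee c88/c89 W-26, A-102; helper shapes for the K_A♭ parent item stmt-NavierStokesRegularity-22987
  `FlatGapCertificatesV2`, child 2A `GradedAdiabaticWakeA` of route TaoLadderRungTwoFlat; cell harvest/h2-tao-ladder)

The tree frame `…Theorems.TaoLadderRungTwoFlatHopTube` fixes the behind conjunct of `InTube` to the sup envelope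
`BehindClause P ε₀ n z`, which the cell RETIRED as hop invariant (LADDER §54.2, TRAP #11); the R54 behind modules
(`R54.behindEnergyClause_hop_of_schedule_sharp`, `R54.exists_behindCap_recentre`, …) conclude the (B1)/(B2) clauses of
`…ZoneGeometry` instead, and nothing composes them to the gap data yet (referee W-26). This file re-types the frame ONCE
with the behind conjunct a PARAMETER `Bcl : ℕ → (Fin 2 → ℤ → ℝ) → Prop` — `InTubeWith`, `tubeSetWith`, `HopPremiseWith`,
the per-hop obligations `TubeStep…With`, `tubeStepLandWith_of_zones`, `TubeStaticsWith`, `TubeExistWith`, and the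
composition `stepToWith_of_obligations` / `gapData₂On_of_tubeWith` / `gradedWake_clause_of_tubeWith` (texts and proofs
of the tree frame verbatim with `BehindClause P ε₀` ↦ `Bcl`; `inTubeWith_behindClause`: the tree frame is the instance
`Bcl := BehindClause P ε₀`) — plus the choice-rule adapters of `…HopRuleGlue` against the parametric frame
(`tubeStep{Core,Near,Behind,Ahead,Anchor,Clock,Land}With_of_good`, A-102) and the R54 INSTANCE
`behindR54 P θ′ Wb n z := R54.BehindEnergyClause P.K θ′ (Wb n) z ∧ ∃ Λ, 0 ≤ Λ ∧ R54.BehindCapClause P.K Λ z`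
((B1) with schedule `Wb`, (B2) EXISTENTIAL per state — p1 g23's recommendation, adopted in LADDER §57.5), whose (B2∃)
half is discharged at frame level for graded mirror flows by `behindCapR54_of_good` (from `R54.exists_behindCap_recentre`),
so that `tubeStepBehindR54_of_good` takes ONLY the (B1) landing `R54.BehindEnergyClause P.K θ′ (Wb (n+1)) (recentre S t a)`
at good times — the conclusion shape of `R54.behindEnergyClause_hop_of_schedule_sharp` / `_fed`.

HONEST FRAMING: pure logic/bookkeeping (definitions + compositions); MODEL lattices only; the obligations remain
HYPOTHESES of the final theorems; nothing certified; no item closed; nothing here is about the Navier–Stokes equations.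
Cell file (theory desk); p1 may land it or re-cut it.
-/

noncomputable section

-- the sub-problem namespace repeats the summit name by design (D-0017)
set_option linter.dupNamespace false

namespace Summit.NavierStokesRegularity.NavierStokesRegularity.Theorems.HopTube

open Set Finset Literature.Analysis.FluidPDE Literature.Analysis.FluidPDE.TaoCascade MirrorPulse

/-! ## The choice-rule adapters against the parametric frame (A-102) -/

section ZonesWith

variable {P : TubeSchedule} {Bcl : ℕ → (Fin 2 → ℤ → ℝ) → Prop} {𝕊 : Finset (ℤ × ℤ × ℤ)} {σ ε₀ : ℝ} {i₀ : Fin 2}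
  {α : Fin 2 → Fin 2 → Fin 2 → ℤ × ℤ × ℤ → ℝ} {X₀ : Fin 2 → ℝ} {w : ℤ → ℝ} {r θ₀ c₀ t₀ : ℝ}
  {ζ : ℕ → Fin 2 → ℤ → ℝ} {ustar : Fin 2 → ℤ → ℝ} {good : ℕ → (Fin 2 → ℤ → ℝ → ℝ) → ℝ → Prop} {n : ℕ}

/-- CORE obligation for the choice rule, parametric tube. [cite: Tao2016AveragedNS, §6.3–6.4; cell LADDER §50.3, §56, referee W-18] -/
theorem tubeStepCoreWith_of_good
    (hex : ∀ z S₀ τ S F, HopPremiseWith P Bcl 𝕊 ε₀ i₀ α X₀ w r c₀ ζ ustar n z S₀ τ S F → ∃ t, good n S t)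
    (hcl : ∀ z S₀ τ S F, HopPremiseWith P Bcl 𝕊 ε₀ i₀ α X₀ w r c₀ ζ ustar n z S₀ τ S F → ∀ t, good n S t →
      CoreClause P i₀ ustar (n + 1) (recentre S t (clampedRatio P i₀ ε₀ θ₀ t S))) :
    TubeStepCoreWith P Bcl (choiceRule P i₀ ε₀ θ₀ t₀ good) 𝕊 ε₀ i₀ α X₀ w r c₀ ζ ustar n := by
  intro z S₀ τ S F h
  exact hcl z S₀ τ S F h _ (chooseTime_spec (hex z S₀ τ S F h))

/-- NEAR obligation for the choice rule, parametric tube. [cite: Tao2016AveragedNS, §6.3–6.4; cell LADDER §49, §50.3] -/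
theorem tubeStepNearWith_of_good
    (hex : ∀ z S₀ τ S F, HopPremiseWith P Bcl 𝕊 ε₀ i₀ α X₀ w r c₀ ζ ustar n z S₀ τ S F → ∃ t, good n S t)
    (hcl : ∀ z S₀ τ S F, HopPremiseWith P Bcl 𝕊 ε₀ i₀ α X₀ w r c₀ ζ ustar n z S₀ τ S F → ∀ t, good n S t →
      NearClause P i₀ ustar (n + 1) (recentre S t (clampedRatio P i₀ ε₀ θ₀ t S))) :
    TubeStepNearWith P Bcl (choiceRule P i₀ ε₀ θ₀ t₀ good) 𝕊 ε₀ i₀ α X₀ w r c₀ ζ ustar n := by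
  intro z S₀ τ S F h
  exact hcl z S₀ τ S F h _ (chooseTime_spec (hex z S₀ τ S F h))

/-- BEHIND obligation for the choice rule, parametric tube. [cite: Tao2016AveragedNS, §6.3–6.4; cell LADDER §50.3, §54 (R54-1), §57.5] -/
theorem tubeStepBehindWith_of_good
    (hex : ∀ z S₀ τ S F, HopPremiseWith P Bcl 𝕊 ε₀ i₀ α X₀ w r c₀ ζ ustar n z S₀ τ S F → ∃ t, good n S t)
    (hcl : ∀ z S₀ τ S F, HopPremiseWith P Bcl 𝕊 ε₀ i₀ α X₀ w r c₀ ζ ustar n z S₀ τ S F → ∀ t, good n S t →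
      Bcl (n + 1) (recentre S t (clampedRatio P i₀ ε₀ θ₀ t S))) :
    TubeStepBehindWith P Bcl (choiceRule P i₀ ε₀ θ₀ t₀ good) 𝕊 ε₀ i₀ α X₀ w r c₀ ζ ustar n := by
  intro z S₀ τ S F h
  exact hcl z S₀ τ S F h _ (chooseTime_spec (hex z S₀ τ S F h))

/-- AHEAD obligation for the choice rule, parametric tube. [cite: Tao2016AveragedNS, §6.2 Prop. 6.3 (ix); cell LADDER §47.5 L1, §50.3] -/
theorem tubeStepAheadWith_of_good
    (hex : ∀ z S₀ τ S F, HopPremiseWith P Bcl 𝕊 ε₀ i₀ α X₀ w r c₀ ζ ustar n z S₀ τ S F → ∃ t, good n S t)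
    (hcl : ∀ z S₀ τ S F, HopPremiseWith P Bcl 𝕊 ε₀ i₀ α X₀ w r c₀ ζ ustar n z S₀ τ S F → ∀ t, good n S t →
      AheadClause P w r (recentre S t (clampedRatio P i₀ ε₀ θ₀ t S))) :
    TubeStepAheadWith P Bcl (choiceRule P i₀ ε₀ θ₀ t₀ good) 𝕊 ε₀ i₀ α X₀ w r c₀ ζ ustar n := by
  intro z S₀ τ S F h
  exact hcl z S₀ τ S F h _ (chooseTime_spec (hex z S₀ τ S F h))

/-- ANCHOR obligation for the choice rule, parametric tube (the upper half is automatic for the clamped ratio).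
[cite: Tao2016AveragedNS, §6.4; cell TRANSFER-CONSTANTS §4, LADDER §50] -/
theorem tubeStepAnchorWith_of_good (hε₀ : -1 < ε₀) (hA : 0 < P.Astar)
    (hex : ∀ z S₀ τ S F, HopPremiseWith P Bcl 𝕊 ε₀ i₀ α X₀ w r c₀ ζ ustar n z S₀ τ S F → ∃ t, good n S t)
    (hdef : ∀ z S₀ τ S F, HopPremiseWith P Bcl 𝕊 ε₀ i₀ α X₀ w r c₀ ζ ustar n z S₀ τ S F → ∀ t, good n S t →
      P.Astar * (1 - P.γ (n + 1)) ≤ |recentre S t (clampedRatio P i₀ ε₀ θ₀ t S) i₀ 0|) :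
    TubeStepAnchorWith P Bcl (choiceRule P i₀ ε₀ θ₀ t₀ good) 𝕊 ε₀ i₀ α X₀ w r c₀ ζ ustar n := by
  intro z S₀ τ S F h
  have hg := chooseTime_spec (t₀ := t₀) (hex z S₀ τ S F h)
  exact ⟨hdef z S₀ τ S F h _ hg, abs_recentre_anchor_le P i₀ hε₀ θ₀ _ S hA⟩

/-- CLOCK/RATIO/SLACK obligation for the choice rule, parametric tube. [cite: Tao2016AveragedNS, §6.4 Prop. 6.5; cell TRANSFER-CONSTANTS §4] -/
theorem tubeStepClockWith_of_good (hε₀ : -1 < ε₀) (hσ : 0 ≤ σ)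
    (hex : ∀ z S₀ τ S F, HopPremiseWith P Bcl 𝕊 ε₀ i₀ α X₀ w r c₀ ζ ustar n z S₀ τ S F → ∃ t, good n S t)
    (hwin : ∀ z S₀ τ S F, HopPremiseWith P Bcl 𝕊 ε₀ i₀ α X₀ w r c₀ ζ ustar n z S₀ τ S F → ∀ t, good n S t →
      0 < t ∧ t ≤ c₀)
    (hslack : ∀ z S₀ τ S F, HopPremiseWith P Bcl 𝕊 ε₀ i₀ α X₀ w r c₀ ζ ustar n z S₀ τ S F → ∀ t, good n S t →
      (1 + σ) * clampedRatio P i₀ ε₀ θ₀ t S ≤ |S i₀ 1 t|) :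
    TubeStepClockWith P Bcl (choiceRule P i₀ ε₀ θ₀ t₀ good) 𝕊 σ ε₀ i₀ α X₀ w r θ₀ c₀ ζ ustar n := by
  intro z S₀ τ S F h
  have hg := chooseTime_spec (t₀ := t₀) (hex z S₀ τ S F h)
  obtain ⟨h1, h2⟩ := hwin z S₀ τ S F h _ hg
  have hs := hslack z S₀ τ S F h _ hg
  have ha := clampedRatio_pos P i₀ hε₀ θ₀ (chooseTime good t₀ n S) S
  refine ⟨h1, h2, ha, floor_le_clampedRatio P i₀ ε₀ θ₀ _ S, ?_, hs⟩
  simp only [choiceRule_τ₁, choiceRule_a] at hs ⊢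
  nlinarith

/-- LANDING obligation for the choice rule from the five zone inputs at good times, parametric tube.
[cite: Tao2016AveragedNS, §6.3–6.4; cell LADDER §50.3, §57.5] -/
theorem tubeStepLandWith_of_good (hε₀ : -1 < ε₀) (hA : 0 < P.Astar)
    (hex : ∀ z S₀ τ S F, HopPremiseWith P Bcl 𝕊 ε₀ i₀ α X₀ w r c₀ ζ ustar n z S₀ τ S F → ∃ t, good n S t)
    (hdef : ∀ z S₀ τ S F, HopPremiseWith P Bcl 𝕊 ε₀ i₀ α X₀ w r c₀ ζ ustar n z S₀ τ S F → ∀ t, good n S t →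
      P.Astar * (1 - P.γ (n + 1)) ≤ |recentre S t (clampedRatio P i₀ ε₀ θ₀ t S) i₀ 0|)
    (hcore : ∀ z S₀ τ S F, HopPremiseWith P Bcl 𝕊 ε₀ i₀ α X₀ w r c₀ ζ ustar n z S₀ τ S F → ∀ t, good n S t →
      CoreClause P i₀ ustar (n + 1) (recentre S t (clampedRatio P i₀ ε₀ θ₀ t S)))
    (hnear : ∀ z S₀ τ S F, HopPremiseWith P Bcl 𝕊 ε₀ i₀ α X₀ w r c₀ ζ ustar n z S₀ τ S F → ∀ t, good n S t →
      NearClause P i₀ ustar (n + 1) (recentre S t (clampedRatio P i₀ ε₀ θ₀ t S)))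
    (hbehind : ∀ z S₀ τ S F, HopPremiseWith P Bcl 𝕊 ε₀ i₀ α X₀ w r c₀ ζ ustar n z S₀ τ S F → ∀ t, good n S t →
      Bcl (n + 1) (recentre S t (clampedRatio P i₀ ε₀ θ₀ t S)))
    (hahead : ∀ z S₀ τ S F, HopPremiseWith P Bcl 𝕊 ε₀ i₀ α X₀ w r c₀ ζ ustar n z S₀ τ S F → ∀ t, good n S t →
      AheadClause P w r (recentre S t (clampedRatio P i₀ ε₀ θ₀ t S))) :
    TubeStepLandWith P Bcl (choiceRule P i₀ ε₀ θ₀ t₀ good) 𝕊 ε₀ i₀ α X₀ w r c₀ ζ ustar n :=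
  tubeStepLandWith_of_zones P Bcl _ 𝕊 ε₀ i₀ α X₀ w r c₀ ζ ustar (tubeStepAnchorWith_of_good hε₀ hA hex hdef)
    (tubeStepCoreWith_of_good hex hcore) (tubeStepNearWith_of_good hex hnear) (tubeStepBehindWith_of_good hex hbehind)
    (tubeStepAheadWith_of_good hex hahead)

end ZonesWith

/-! ## The R54 instance: (B1) block-energy clause with schedule `Wb`, (B2) existential cap -/

/-- **The R54 behind clause** at hop `n`: (B1) `R54.BehindEnergyClause P.K θ′ (Wb n) z` (geometrically weighted block
energies behind the window under the schedule `Wb`) and (B2∃) `∃ Λ ≥ 0, R54.BehindCapClause P.K Λ z` (the state is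
bounded behind the window; size immaterial). [cite: Tao2016AveragedNS, §6.2 Prop. 6.3, §6.3–6.4 (statement shape); cell LADDER §54 (R54-1), §57.5] -/
def behindR54 (P : TubeSchedule) (θ' : ℝ) (Wb : ℕ → ℝ) (n : ℕ) (z : Fin 2 → ℤ → ℝ) : Prop :=
  R54.BehindEnergyClause P.K θ' (Wb n) z ∧ ∃ Λ : ℝ, 0 ≤ Λ ∧ R54.BehindCapClause P.K Λ z

section R54Instance

variable {P : TubeSchedule} {θ' : ℝ} {Wb : ℕ → ℝ} {σ ε ε₀ : ℝ} {i₀ : Fin 2} {X₀ : Fin 2 → ℝ} {w : ℤ → ℝ}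
  {r θ₀ c₀ t₀ : ℝ} {ζ : ℕ → Fin 2 → ℤ → ℝ} {ustar : Fin 2 → ℤ → ℝ} {good : ℕ → (Fin 2 → ℤ → ℝ → ℝ) → ℝ → Prop}
  {n : ℕ}

/-- **(B2∃) at good times, for free.** Along a graded mirror hop flow from the R54 tube, at every good time `t` in the
clock window `0 < t ≤ c₀ (≤ τ)` the re-centred state at the clamped ratio is bounded behind the window (from the format
clause (4.5) via `R54.exists_behindCap_recentre`). [cite: Tao2016AveragedNS, §4 (4.5), §6.3–6.4 (statement shape); cell LADDER §57.5] -/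
theorem behindCapR54_of_good (hε₀ : -1 < ε₀)
    (hwin : ∀ z S₀ τ S F, HopPremiseWith P (behindR54 P θ' Wb) shiftSetFlat ε₀ i₀ (mirrorTable ε ε) X₀ w r c₀ ζ
      ustar n z S₀ τ S F → ∀ t, good n S t → 0 < t ∧ t ≤ c₀) :
    ∀ z S₀ τ S F, HopPremiseWith P (behindR54 P θ' Wb) shiftSetFlat ε₀ i₀ (mirrorTable ε ε) X₀ w r c₀ ζ ustar n
      z S₀ τ S F → ∀ t, good n S t →
        ∃ Λ : ℝ, 0 ≤ Λ ∧ R54.BehindCapClause P.K Λ (recentre S t (clampedRatio P i₀ ε₀ θ₀ t S)) := by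
  intro z S₀ τ S F h t ht
  obtain ⟨h0, hc⟩ := hwin z S₀ τ S F h t ht
  obtain ⟨-, -, hc₀τ, hflow⟩ := h
  exact R54.exists_behindCap_recentre hflow hε₀.le ⟨h0.le, hc.trans hc₀τ⟩ (clampedRatio_pos P i₀ hε₀ θ₀ t S) P.K

/-- **BEHIND obligation of the R54 tube for the choice rule from the (B1) landing alone.** The (B2∃) half is
`behindCapR54_of_good`; the input `hB1` is the conclusion shape of `R54.behindEnergyClause_hop_of_schedule_sharp` /
`R54.behindEnergyClause_hop_of_schedule_fed` at the good time and the clamped ratio. [cite: Tao2016AveragedNS, §6.3–6.4 (statement shape); cell LADDER §54 (R54-1), §57.5] -/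
theorem tubeStepBehindR54_of_good (hε₀ : -1 < ε₀)
    (hex : ∀ z S₀ τ S F, HopPremiseWith P (behindR54 P θ' Wb) shiftSetFlat ε₀ i₀ (mirrorTable ε ε) X₀ w r c₀ ζ
      ustar n z S₀ τ S F → ∃ t, good n S t)
    (hwin : ∀ z S₀ τ S F, HopPremiseWith P (behindR54 P θ' Wb) shiftSetFlat ε₀ i₀ (mirrorTable ε ε) X₀ w r c₀ ζ
      ustar n z S₀ τ S F → ∀ t, good n S t → 0 < t ∧ t ≤ c₀)
    (hB1 : ∀ z S₀ τ S F, HopPremiseWith P (behindR54 P θ' Wb) shiftSetFlat ε₀ i₀ (mirrorTable ε ε) X₀ w r c₀ ζ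
      ustar n z S₀ τ S F → ∀ t, good n S t →
        R54.BehindEnergyClause P.K θ' (Wb (n + 1)) (recentre S t (clampedRatio P i₀ ε₀ θ₀ t S))) :
    TubeStepBehindWith P (behindR54 P θ' Wb) (choiceRule P i₀ ε₀ θ₀ t₀ good) shiftSetFlat ε₀ i₀ (mirrorTable ε ε)
      X₀ w r c₀ ζ ustar n :=
  tubeStepBehindWith_of_good hex fun z S₀ τ S F h t ht =>
    ⟨hB1 z S₀ τ S F h t ht, behindCapR54_of_good hε₀ hwin z S₀ τ S F h t ht⟩

/-- What the R54 tube hands the behind hop lemma at hop `n > N₀`: the (B1) clause `R54.BehindEnergyClause P.K θ′ (Wb n) z`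
of the tube state (the `hW` input of `R54.behindEnergyClause_hop_of_schedule_sharp` / `_fed`) and its (B2∃) bound.
[cite: Tao2016AveragedNS, §6.3–6.4 (statement shape); cell LADDER §57.5] -/
theorem behindR54_of_hopPremiseWith {𝕊 : Finset (ℤ × ℤ × ℤ)} {α : Fin 2 → Fin 2 → Fin 2 → ℤ × ℤ × ℤ → ℝ}
    {z S₀ : Fin 2 → ℤ → ℝ} {τ : ℝ} {S F : Fin 2 → ℤ → ℝ → ℝ} (hn : P.N₀ < n)
    (h : HopPremiseWith P (behindR54 P θ' Wb) 𝕊 ε₀ i₀ α X₀ w r c₀ ζ ustar n z S₀ τ S F) :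
    R54.BehindEnergyClause P.K θ' (Wb n) z ∧ ∃ Λ : ℝ, 0 ≤ Λ ∧ R54.BehindCapClause P.K Λ z := by
  obtain ⟨hz, -, -, -⟩ := h
  have h0 : n ≠ 0 := by omega
  have h1 : ¬ n ≤ P.N₀ := by omega
  simp only [InTubeWith, h0, if_false, h1] at hz
  exact hz.2.2.2.1

end R54Instance

end Summit.NavierStokesRegularity.NavierStokesRegularity.Theorems.HopTube

end
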